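import Summits.QuantumFields.BalabanUV.Beta.GAN24.WilsonFaceCurrentProfile
import Summits.QuantumFields.BalabanUV.Beta.GAN24.PeriodicKKTExchangePairing
import Summits.QuantumFields.BalabanUV.Beta.GAN24.FineReadoutCauchyReal

/-!
# `BalabanUV.Beta.GAN24.WilsonProfilePairing` — binder row G-an2-4 ∕ (CONV-C), W-slot (α-0), typer's PART VI row **T6-VAL**, the (γ) hand's letter **K7-0** (the «Wilson
# remainder» `R m` of leaf-03 g72's `CrossedLedgerClosure` ∕ this lineage's `CrossedLedgerTelescope.valLedger_iff_levelZero`): **THE LEVEL-`0` PAIRING OF THE DEPTH TOWER IS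
# RATIONAL** — `⟨q^{(M)}_{μα}, E2_0 q^{(M)}_{νβ}⟩_{box M} = ⟨curv q^{(M)}_{μα}, curv q^{(M)}_{νβ}⟩_{box M} = 2·([μ=ν][α=β] − [μ=β][α=ν])·M^{d−1}·(1 − M⁻²)`
# (`μ ≠ α`, `ν ≠ β`, every `M ≥ 1`, every `d`, every `Lc ≥ 1`; `E2_0 = d*d` the Wilson Hessian) — the pair-form tensor times `(M² − 1)·M^{d−3}`
# (G-an2-4 CRUX TEAM (2), seat `b2b-balaban-gan24-formalise-leaf-06` = the (γ) hand, gen 57; journal [GAN24LEAF06-G57-INTENT-1])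

NOT IN PRINT; OUR BOOKKEEPING ([folklore] finite cell algebra BY NAME: this seat's `ValueHessianLevelZero.tsum_E2_zero_apply_form` (`E2_0 q = d*d q`) and
`WilsonFaceCurrentProfile.curv_qProfileM` (`curv q^{(M)}_{νβ} = χ_ν⊗χ_β − M⁻²·e_ν∧e_β`), leaf-04's `PeriodicCellPairing.sum_box_curvAdj_mul` (`curvAdj ⊣ curv` on cell sums) and
`PeriodicKKTExchangePairing.sum_coef_mul_coef ∕ sum_box_mul_coord`; 0 `def`, 0 cited fact, 0 `def … : Prop`, 0 sorry).
HONEST FRAMING (cell contract, verbatim): «discharging `BetaPertH` makes Bałaban's UV stability UNCONDITIONAL — a real constructive-QFT result; it is NOT the continuum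
limit and NOT the Clay problem.»  HONEST DEPENDENCY (verbatim): «continuum YM on T⁴ ⇐ BetaPertH ∧ nine spine estimates (0/9 proved); BetaPertH ⇐ (D1) ∧ (D4) ∧ CAP+tail;
G-an2-4 gates asym, D1 and NE2/3/4.»

WHY (memo `HOME/b2b-balaban-gan24-formalise-leaf-06/g55/HX-VALUES-g55.md` §6; `g56/K7-NUMERICS-g56.md` §4).  In the depth tower of row T6-VAL every pairing `V(i, n) = ⟨q^{(Lc^n)}, E2_i q^{(Lc^n)}⟩`
at a level `i ≥ 1` is a Green's-function number which CANCELS in the telescope; what is left is the level-`0` column `V(0, ·)` — and by this seat's `FaceWordEEValueZero` the level-`0`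
face words have the common shape with `E2_0 = d*d`.  THIS FILE values `V(0, ·)`: by cell adjointness it is `⟨curv q, curv q⟩_{box M}`, and `curv q^{(M)}` is the plaquette column of
exit indicators minus its cell average, so the number is `(pair tensor)·(Σ_{cell} χ_νχ_β − M⁻⁴·|box M|·M²…) = 2·(…)·M^{d−1}(1 − M⁻²)` — g56's measured `R(N) ∝ (1 − N⁻²)` (D = 2,
N = 3, 9, 27) and the `(N_m² − 1)` law in leaf-03 g72's target, in the tree's currency (prefactors: `FaceWordEEValueZero.cellPairing_zero_value_units`).

WHAT ([folklore]): §1 tools (`curv_periodic_of_periodic`, `sum_range_exitInd`, `sum_box_exitInd_mul_exitInd`; `|box M| = M^{d+1}` is the tree's `FineReadoutCauchyReal.card_box_eq` BY NAME — v1.1: v1's α-twin `card_box_real` is no longer declared, the OWNER's W-gan24p1-g41-2 (2)); §2 **`sum_box_qProfile_E2zero_qProfile`** —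
the display.  Asserts NO value of Bałaban's tables beyond this finite identity; discharges NOTHING of `hX` ∕ `hXu` ∕ (C)_{≥1} ∕ `hB0` ∕ `hBF` ∕ (Q-L); NEVER «G-an2-4 closed» as
(CONV-C); NOT D1, NOT `BetaPertH`, NOT continuum, NOT Clay.  2026-08-24; no existing file touched.
-/

noncomputable section

open Finset
open scoped BigOperators
open Literature.MathematicalPhysics.QuantumFieldTheory
open Literature.MathematicalPhysics.QuantumFieldTheory.Balaban1983to89
open Literature.MathematicalPhysics.QuantumFieldTheory.Balaban1983to89.Beta
open ExpKernelCalculus (Site)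
open AffineAveraging (Form1 Form2 box toSite unitVec curv curvAdj)
open PeriodicDescent (IsPeriodic)
open BalabanStepJetsSucc (E2)
open Summit.QuantumFields.BalabanUV.Beta.GAN24.ValueHessianLevelZero (tsum_E2_zero_apply_form)
open Summit.QuantumFields.BalabanUV.Beta.GAN24.WilsonFaceCurrentProfile (curv_qProfileM qProfileM_periodic')
open Summit.QuantumFields.BalabanUV.Beta.GAN24.PeriodicCellPairing (sum_box_curvAdj_mul)
open Summit.QuantumFields.BalabanUV.Beta.GAN24.PeriodicKKTExchangePairing (sum_coef_mul_coef sum_box_mul_coord)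

namespace Summit.QuantumFields.BalabanUV.Beta.GAN24.WilsonProfilePairing

variable {d : ℕ}

/-! ## §1 Tools -/

/-- [folklore] The curvature of a coordinatewise `M`-periodic 1-form is `M`-periodic. -/
theorem curv_periodic_of_periodic {M : ℕ} {A : Form1 (d + 1) ℝ} (hA : ∀ κ, IsPeriodic M (A κ)) (κ l : Fin (d + 1)) : IsPeriodic M (curv A κ l) := by
  intro x a
  simp only [AffineAveraging.curv, add_right_comm x ((M : ℤ) • a) _, hA κ x a, hA l x a, hA κ (x + unitVec l) a, hA l (x + unitVec κ) a]

/-- [folklore] Exactly one residue in `[0, M)` is the exit residue: `Σ_{t<M} [t mod M = M − 1] = 1` (`M ≥ 1`). -/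
theorem sum_range_exitInd {M : ℕ} (hM : 1 ≤ M) :
    ∑ t ∈ Finset.range M, (if ((t : ℕ) : ℤ) % (M : ℤ) = (M : ℤ) - 1 then (1 : ℝ) else 0) = 1 := by
  have e : ∀ t ∈ Finset.range M, (if ((t : ℕ) : ℤ) % (M : ℤ) = (M : ℤ) - 1 then (1 : ℝ) else 0) = if t = M - 1 then (1 : ℝ) else 0 := by
    intro t ht
    have htM : t < M := Finset.mem_range.mp ht
    have hmod : ((t : ℕ) : ℤ) % (M : ℤ) = (t : ℤ) := Int.emod_eq_of_lt (by positivity) (by exact_mod_cast htM)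
    rw [hmod]
    by_cases h : t = M - 1
    · rw [if_pos h, if_pos]
      rw [h]; push_cast [Nat.cast_sub hM]; ring
    · rw [if_neg h, if_neg]
      intro h'
      apply h
      have : (t : ℤ) = (M : ℤ) - 1 := h'
      omega
  rw [Finset.sum_congr rfl e, Finset.sum_ite_eq' (Finset.range M) (M - 1) (fun _ => (1 : ℝ))]
  rw [if_pos (Finset.mem_range.mpr (Nat.sub_lt hM Nat.one_pos))]

/-- [folklore] **TWO PINNED COORDINATES**: `Σ_{x ∈ box M} χ_M(x_ν)·χ_M(x_β) = M^{d−1}` (`ν ≠ β`, `M ≥ 1`). -/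
theorem sum_box_exitInd_mul_exitInd {M : ℕ} (hM : 1 ≤ M) {ν β : Fin (d + 1)} (hνβ : ν ≠ β) :
    ∑ x ∈ box (d + 1) M, (if toSite x ν % (M : ℤ) = (M : ℤ) - 1 then (1 : ℝ) else 0) * (if toSite x β % (M : ℤ) = (M : ℤ) - 1 then (1 : ℝ) else 0) = (M : ℝ) ^ (d - 1) := by
  haveI : NeZero M := ⟨Nat.one_le_iff_ne_zero.mp hM⟩
  rw [sum_box_mul_coord (N := M) hνβ (fun n : ℤ => if n % (M : ℤ) = (M : ℤ) - 1 then (1 : ℝ) else 0)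
      (fun n : ℤ => if n % (M : ℤ) = (M : ℤ) - 1 then (1 : ℝ) else 0), sum_range_exitInd hM, mul_one, mul_one]

/-! ## §2 The level-`0` pairing of the depth tower, valued -/

/-- NOT IN PRINT; OUR BOOKKEEPING.  **`⟨q^{(M)}_{μα}, E2_0 q^{(M)}_{νβ}⟩_{box M} = 2·([μ=ν][α=β] − [μ=β][α=ν])·M^{d−1}·(1 − M⁻²)`** (`μ ≠ α`, `ν ≠ β`, `M ≥ 1`, every `Lc ≥ 1`):
`E2_0` is the Wilson Hessian, cell adjointness turns the pairing into `⟨curv q_{νβ}, curv q_{μα}⟩_{box M}`, both curvatures are `(pattern)·(χχ − M⁻²)` with the pattern products summing to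
the pair tensor, and `Σ_{x∈box M}(χ_νχ_β − M⁻²)² = M^{d−1} − 2M^{d−1}M⁻² + M^{d+1}M⁻⁴ = M^{d−1}(1 − M⁻²)`. -/
theorem sum_box_qProfile_E2zero_qProfile (Lc : ℕ) [NeZero Lc] {M : ℕ} (hM : 1 ≤ M) {μ α ν β : Fin (d + 1)} (hμα : μ ≠ α) (hνβ : ν ≠ β) :
    ∑ x ∈ box (d + 1) M, ∑ b : Fin (d + 1),
        ((if b = μ then (((M : ℝ))⁻¹ * ((M : ℝ))⁻¹) * ((((toSite x α % (M : ℤ) : ℤ) : ℝ) - (((M : ℝ)) - 1) / 2)) else 0)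
        + (if b = α then (-((M : ℝ))⁻¹ * ((((toSite x μ % (M : ℤ) : ℤ) : ℝ) - (((M : ℝ)) - 1) / 2))) *
            (if toSite x α % (M : ℤ) = (M : ℤ) - 1 then (1 : ℝ) else 0) else 0)) *
        ∑' s : Site (d + 1), ∑ b' : Fin (d + 1), E2 d Lc 0 (toSite x) s (Sum.inl b) (Sum.inl b') *
          ((if b' = ν then (((M : ℝ))⁻¹ * ((M : ℝ))⁻¹) * ((((s β % (M : ℤ) : ℤ) : ℝ) - (((M : ℝ)) - 1) / 2)) else 0)
        + (if b' = β then (-((M : ℝ))⁻¹ * ((((s ν % (M : ℤ) : ℤ) : ℝ) - (((M : ℝ)) - 1) / 2))) *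
            (if s β % (M : ℤ) = (M : ℤ) - 1 then (1 : ℝ) else 0) else 0)) =
      2 * ((if μ = ν ∧ α = β then (1 : ℝ) else 0) - (if μ = β ∧ α = ν then (1 : ℝ) else 0)) * ((M : ℝ) ^ (d - 1) * (1 - (M : ℝ)⁻¹ * (M : ℝ)⁻¹)) := by
  have hM0 : (M : ℝ) ≠ 0 := by exact_mod_cast (Nat.one_le_iff_ne_zero.mp hM)
  -- `d ≥ 1` since `Fin (d+1)` has two distinct elements
  haveI : NeZero M := ⟨Nat.one_le_iff_ne_zero.mp hM⟩
  have hd : 1 ≤ d := by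
    by_contra h0
    have hd0 : d = 0 := by omega
    subst hd0
    exact hνβ (Fin.ext (by have := ν.isLt; have := β.isLt; omega))
  -- `E2_0 = d*d`
  simp_rw [tsum_E2_zero_apply_form Lc _ _]
  -- cell adjointness: `Σ q·(d*d q′) = Σ curv q′ · curv q`
  have hper : ∀ κ, IsPeriodic M ((fun (b : Fin (d + 1)) (y : Site (d + 1)) =>
      ((if b = μ then (((M : ℝ))⁻¹ * ((M : ℝ))⁻¹) * ((((y α % (M : ℤ) : ℤ) : ℝ) - (((M : ℝ)) - 1) / 2)) else 0)
        + (if b = α then (-((M : ℝ))⁻¹ * ((((y μ % (M : ℤ) : ℤ) : ℝ) - (((M : ℝ)) - 1) / 2))) *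
            (if y α % (M : ℤ) = (M : ℤ) - 1 then (1 : ℝ) else 0) else 0))) κ) :=
    fun κ y a => (qProfileM_periodic' (d := d) M μ α κ y a).symm
  have hperR : ∀ κ, IsPeriodic M ((fun (b' : Fin (d + 1)) (s : Site (d + 1)) =>
      ((if b' = ν then (((M : ℝ))⁻¹ * ((M : ℝ))⁻¹) * ((((s β % (M : ℤ) : ℤ) : ℝ) - (((M : ℝ)) - 1) / 2)) else 0)
        + (if b' = β then (-((M : ℝ))⁻¹ * ((((s ν % (M : ℤ) : ℤ) : ℝ) - (((M : ℝ)) - 1) / 2))) *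
            (if s β % (M : ℤ) = (M : ℤ) - 1 then (1 : ℝ) else 0) else 0))) κ) :=
    fun κ y a => (qProfileM_periodic' (d := d) M ν β κ y a).symm
  have hcomm : ∀ x ∈ box (d + 1) M, (∑ b : Fin (d + 1),
      ((if b = μ then (((M : ℝ))⁻¹ * ((M : ℝ))⁻¹) * ((((toSite x α % (M : ℤ) : ℤ) : ℝ) - (((M : ℝ)) - 1) / 2)) else 0)
        + (if b = α then (-((M : ℝ))⁻¹ * ((((toSite x μ % (M : ℤ) : ℤ) : ℝ) - (((M : ℝ)) - 1) / 2))) *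
            (if toSite x α % (M : ℤ) = (M : ℤ) - 1 then (1 : ℝ) else 0) else 0)) *
        curvAdj (curv (fun (b' : Fin (d + 1)) (s : Site (d + 1)) =>
          ((if b' = ν then (((M : ℝ))⁻¹ * ((M : ℝ))⁻¹) * ((((s β % (M : ℤ) : ℤ) : ℝ) - (((M : ℝ)) - 1) / 2)) else 0)
        + (if b' = β then (-((M : ℝ))⁻¹ * ((((s ν % (M : ℤ) : ℤ) : ℝ) - (((M : ℝ)) - 1) / 2))) *
            (if s β % (M : ℤ) = (M : ℤ) - 1 then (1 : ℝ) else 0) else 0)))) b (toSite x)) =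
      ∑ b : Fin (d + 1), curvAdj (curv (fun (b' : Fin (d + 1)) (s : Site (d + 1)) =>
          ((if b' = ν then (((M : ℝ))⁻¹ * ((M : ℝ))⁻¹) * ((((s β % (M : ℤ) : ℤ) : ℝ) - (((M : ℝ)) - 1) / 2)) else 0)
        + (if b' = β then (-((M : ℝ))⁻¹ * ((((s ν % (M : ℤ) : ℤ) : ℝ) - (((M : ℝ)) - 1) / 2))) *
            (if s β % (M : ℤ) = (M : ℤ) - 1 then (1 : ℝ) else 0) else 0)))) b (toSite x) *
        (fun (b : Fin (d + 1)) (y : Site (d + 1)) =>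
          ((if b = μ then (((M : ℝ))⁻¹ * ((M : ℝ))⁻¹) * ((((y α % (M : ℤ) : ℤ) : ℝ) - (((M : ℝ)) - 1) / 2)) else 0)
        + (if b = α then (-((M : ℝ))⁻¹ * ((((y μ % (M : ℤ) : ℤ) : ℝ) - (((M : ℝ)) - 1) / 2))) *
            (if y α % (M : ℤ) = (M : ℤ) - 1 then (1 : ℝ) else 0) else 0))) b (toSite x) :=
    fun x _ => Finset.sum_congr rfl fun b _ => by ring
  rw [Finset.sum_congr rfl hcomm, sum_box_curvAdj_mul (N := M) (fun κ l => curv_periodic_of_periodic hperR κ l) hper]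
  -- both curvatures in closed form; the pattern products sum to the pair tensor
  simp_rw [curv_qProfileM hM hνβ, curv_qProfileM hM hμα]
  have hx : ∀ x : Fin (d + 1) → ℕ, (∑ κ : Fin (d + 1), ∑ l : Fin (d + 1),
      ((if κ = ν ∧ l = β then (1 : ℝ) else 0) - (if κ = β ∧ l = ν then (1 : ℝ) else 0)) *
          ((if toSite x ν % (M : ℤ) = (M : ℤ) - 1 then (1 : ℝ) else 0) * (if toSite x β % (M : ℤ) = (M : ℤ) - 1 then (1 : ℝ) else 0) - (M : ℝ)⁻¹ * (M : ℝ)⁻¹) *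
        (((if κ = μ ∧ l = α then (1 : ℝ) else 0) - (if κ = α ∧ l = μ then (1 : ℝ) else 0)) *
          ((if toSite x μ % (M : ℤ) = (M : ℤ) - 1 then (1 : ℝ) else 0) * (if toSite x α % (M : ℤ) = (M : ℤ) - 1 then (1 : ℝ) else 0) - (M : ℝ)⁻¹ * (M : ℝ)⁻¹))) =
      2 * ((if ν = μ ∧ β = α then (1 : ℝ) else 0) - (if ν = α ∧ β = μ then (1 : ℝ) else 0)) *
        (((if toSite x ν % (M : ℤ) = (M : ℤ) - 1 then (1 : ℝ) else 0) * (if toSite x β % (M : ℤ) = (M : ℤ) - 1 then (1 : ℝ) else 0) - (M : ℝ)⁻¹ * (M : ℝ)⁻¹) *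
          ((if toSite x μ % (M : ℤ) = (M : ℤ) - 1 then (1 : ℝ) else 0) * (if toSite x α % (M : ℤ) = (M : ℤ) - 1 then (1 : ℝ) else 0) - (M : ℝ)⁻¹ * (M : ℝ)⁻¹)) := by
    intro x
    rw [← sum_coef_mul_coef μ α ν β, Finset.sum_mul]
    refine Finset.sum_congr rfl fun κ _ => ?_
    rw [Finset.sum_mul]
    exact Finset.sum_congr rfl fun l _ => by ring
  rw [Finset.sum_congr rfl fun x _ => hx x, ← Finset.mul_sum]
  -- the pair tensor: either zero, or the two planes coincide
  by_cases hsame : ν = μ ∧ β = α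
  · obtain ⟨rfl, rfl⟩ := hsame
    have hνβ' : ¬(ν = β ∧ β = ν) := fun h => hνβ h.1
    have eT : (if ν = ν ∧ β = β then (1 : ℝ) else 0) = 1 := if_pos ⟨rfl, rfl⟩
    rw [eT, if_neg hνβ']
    have hsq : ∑ x ∈ box (d + 1) M, ((if toSite x ν % (M : ℤ) = (M : ℤ) - 1 then (1 : ℝ) else 0) * (if toSite x β % (M : ℤ) = (M : ℤ) - 1 then (1 : ℝ) else 0) - (M : ℝ)⁻¹ * (M : ℝ)⁻¹) *
        ((if toSite x ν % (M : ℤ) = (M : ℤ) - 1 then (1 : ℝ) else 0) * (if toSite x β % (M : ℤ) = (M : ℤ) - 1 then (1 : ℝ) else 0) - (M : ℝ)⁻¹ * (M : ℝ)⁻¹) =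
        (M : ℝ) ^ (d - 1) * (1 - (M : ℝ)⁻¹ * (M : ℝ)⁻¹) := by
      have hidem : ∀ x : Fin (d + 1) → ℕ, ((if toSite x ν % (M : ℤ) = (M : ℤ) - 1 then (1 : ℝ) else 0) * (if toSite x β % (M : ℤ) = (M : ℤ) - 1 then (1 : ℝ) else 0) - (M : ℝ)⁻¹ * (M : ℝ)⁻¹) *
          ((if toSite x ν % (M : ℤ) = (M : ℤ) - 1 then (1 : ℝ) else 0) * (if toSite x β % (M : ℤ) = (M : ℤ) - 1 then (1 : ℝ) else 0) - (M : ℝ)⁻¹ * (M : ℝ)⁻¹) =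
          (1 - 2 * ((M : ℝ)⁻¹ * (M : ℝ)⁻¹)) * ((if toSite x ν % (M : ℤ) = (M : ℤ) - 1 then (1 : ℝ) else 0) * (if toSite x β % (M : ℤ) = (M : ℤ) - 1 then (1 : ℝ) else 0)) +
            ((M : ℝ)⁻¹ * (M : ℝ)⁻¹) * ((M : ℝ)⁻¹ * (M : ℝ)⁻¹) := by
        intro x
        split_ifs <;> ring
      rw [Finset.sum_congr rfl fun x _ => hidem x, Finset.sum_add_distrib, ← Finset.mul_sum, sum_box_exitInd_mul_exitInd hM hνβ, Finset.sum_const,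
        nsmul_eq_mul, FineReadoutCauchyReal.card_box_eq]
      have hpow : (M : ℝ) ^ (d + 1) = (M : ℝ) ^ (d - 1) * ((M : ℝ) * (M : ℝ)) := by
        rw [← pow_two, ← pow_add]
        congr 1
        omega
      rw [hpow]
      field_simp
      ring
    rw [hsq]
  · rw [if_neg hsame]
    by_cases hswap : ν = α ∧ β = μ
    · obtain ⟨rfl, rfl⟩ := hswap
      have h2 : ¬(β = ν ∧ ν = β) := fun h => hνβ h.2
      have eT1 : (if ν = ν ∧ β = β then (1 : ℝ) else 0) = 1 := if_pos ⟨rfl, rfl⟩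
      have eT2 : (if β = β ∧ ν = ν then (1 : ℝ) else 0) = 1 := if_pos ⟨rfl, rfl⟩
      rw [eT1, eT2, if_neg h2]
      have hsq : ∑ x ∈ box (d + 1) M, ((if toSite x ν % (M : ℤ) = (M : ℤ) - 1 then (1 : ℝ) else 0) * (if toSite x β % (M : ℤ) = (M : ℤ) - 1 then (1 : ℝ) else 0) - (M : ℝ)⁻¹ * (M : ℝ)⁻¹) *
          ((if toSite x β % (M : ℤ) = (M : ℤ) - 1 then (1 : ℝ) else 0) * (if toSite x ν % (M : ℤ) = (M : ℤ) - 1 then (1 : ℝ) else 0) - (M : ℝ)⁻¹ * (M : ℝ)⁻¹) =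
          (M : ℝ) ^ (d - 1) * (1 - (M : ℝ)⁻¹ * (M : ℝ)⁻¹) := by
        have hidem : ∀ x : Fin (d + 1) → ℕ, ((if toSite x ν % (M : ℤ) = (M : ℤ) - 1 then (1 : ℝ) else 0) * (if toSite x β % (M : ℤ) = (M : ℤ) - 1 then (1 : ℝ) else 0) - (M : ℝ)⁻¹ * (M : ℝ)⁻¹) *
            ((if toSite x β % (M : ℤ) = (M : ℤ) - 1 then (1 : ℝ) else 0) * (if toSite x ν % (M : ℤ) = (M : ℤ) - 1 then (1 : ℝ) else 0) - (M : ℝ)⁻¹ * (M : ℝ)⁻¹) =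
            (1 - 2 * ((M : ℝ)⁻¹ * (M : ℝ)⁻¹)) * ((if toSite x ν % (M : ℤ) = (M : ℤ) - 1 then (1 : ℝ) else 0) * (if toSite x β % (M : ℤ) = (M : ℤ) - 1 then (1 : ℝ) else 0)) +
              ((M : ℝ)⁻¹ * (M : ℝ)⁻¹) * ((M : ℝ)⁻¹ * (M : ℝ)⁻¹) := by
          intro x
          split_ifs <;> ring
        rw [Finset.sum_congr rfl fun x _ => hidem x, Finset.sum_add_distrib, ← Finset.mul_sum, sum_box_exitInd_mul_exitInd hM hνβ, Finset.sum_const,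
          nsmul_eq_mul, FineReadoutCauchyReal.card_box_eq]
        have hpow : (M : ℝ) ^ (d + 1) = (M : ℝ) ^ (d - 1) * ((M : ℝ) * (M : ℝ)) := by
          rw [← pow_two, ← pow_add]
          congr 1
          omega
        rw [hpow]
        field_simp
        ring
      rw [hsq]
    · have h3 : ¬(μ = ν ∧ α = β) := fun h => hsame ⟨h.1.symm, h.2.symm⟩
      have h4 : ¬(μ = β ∧ α = ν) := fun h => hswap ⟨h.2.symm, h.1.symm⟩
      rw [if_neg hswap, if_neg h3, if_neg h4]
      ring

end Summit.QuantumFields.BalabanUV.Beta.GAN24.WilsonProfilePairing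

end
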